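import Literature.Computability.Complexity.FKPointLocationProtocolDefs
import HarnessLib

/-!
# Fournier–Koiran point location, XVIII: the one-bit protocol runs the typed location procedure

Topic `Literature/Computability/Complexity`, grouping namespace `FKPointLocation`. The one-bit
protocol of `FKPointLocationProtocolDefs.lean` (Fournier–Koiran, ICALP 2000 = LIP RR-1999-21, §2,
Thm 2, in the rendering of `FKProtocolDriver.lean`) SIMULATES the typed location procedure of
`FKPointLocationProtocol.lean` on `x̂ = (x, 1)`:

* `signEnv_squeryList` / `signEnv_qryOf` — a sign question is answered by the sign of the queried
  form at `x̂` (padding lemma `signEnv_encode_append`, `toU_queryForm`, §2.3 `x_{n+1} = 1`);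
* `mem_LnpOf_iff` — an `NP` question is answered by the typed statement `npTruth` (soundness and
  completeness of the certificates, `FKPointLocationNPChecks.lean`; the clamps of `ucheck` are inactive
  on the schedule, `ucheck_toU`);
* **`answers_eq_tans`** — for `t ≤ |agenda|` the answers against `signEnv x` ARE the typed truthful
  answers and the replayed state is the untyped image of the typed state; **`ustate_answers`** — after
  the schedule the replayed state is the image of `finalData` (whose certificate is valid,
  `finalData_valid`).

## References

* H. Fournier, P. Koiran, *Lower bounds are not easier over the reals: inside PH*, ICALP 2000,
  LNCS 1853 = LIP RR-1999-21, §2.1, §2.3, Thm 2, Thm 3 (p. 11). [FournierKoiran2000]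
-/

namespace Literature.Computability.Complexity

namespace FKPointLocation

open _root_.Computability CodeFP Polynomial FKTransfer Brick

/-! ### Size of the replayed state -/

/-- The replayed state satisfies the size invariant (for some magnitude exponent). [cite: FournierKoiran2000, §2.2] -/
theorem usz_ustate (P : UParams) (prev : List Bool) : ∃ K, USz P K (uagenda P).length (ustate P prev) := by
  have h0 : USz P (P.K₀ + 3 * 0) 0 (UData.init P.D) := usz_init P _ 0 (by unfold UParams.K₀; omega)
  have h := usz_ustep_foldl P prev le_rfl ((List.range (uagenda P).length).zip (uagenda P)) 0 _ h0
  simp only [Nat.zero_add, List.length_zip, List.length_range, min_self] at h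
  exact ⟨_, h⟩

/-! ### The sign questions -/

section Sign

variable {n : ℕ}

/-- **The value probed by `squeryList` is the value of the homogeneous form at `x̂`**: for a typed form
`φ` on `ℝ^{n+1}`, `[0 ≤ aff φ x̂]` is the sign-environment bit of the code of `squeryList n (affToU φ)`,
whatever padding follows. [cite: FournierKoiran2000, §2.3 ("Proposition 1 will follow by setting `x_{n+1} = 1`")] -/
theorem signEnv_squeryList (x : Fin n → ℝ) (φ : AffForm (n + 1)) (pad : List Bool) :
    signEnv x ((encodingIntBool.listBool).encode (squeryList n (affToU φ)) ++ pad) = decide (0 ≤ aff φ (hat x)) := by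
  rw [signEnv_encode_append, signEnv, affineQueryValue_encode]
  congr 1
  have h0 : (squeryList n (affToU φ)).getD 0 0 = φ.1 (Fin.last n) + φ.2 := by
    simp only [squeryList, affToU, List.getD_cons_zero]
    exact congrArg (· + φ.2) (vget_ofFn φ.1 (Fin.last n))
  have hi : ∀ i : Fin n, (squeryList n (affToU φ)).getD (i.val + 1) 0 = φ.1 i.castSucc := by
    intro i
    simp only [squeryList, affToU, List.getD_cons_succ]
    rw [List.getD_eq_getElem _ _ (by simp [i.isLt]), List.getElem_take, List.getElem_ofFn]
    rfl
  rw [h0, aff, lin, Fin.sum_univ_castSucc]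
  simp only [hi, hat, Fin.snoc_castSucc, Fin.snoc_last, mul_one, Int.cast_add]
  apply propext
  constructor <;> intro h <;> linarith

end Sign

/-! ### The simulation -/

section Simulation

variable {T : Polynomial ℕ} {m qc : Polynomial ℕ} {n : ℕ} {x : Fin n → ℝ}

/-- The scheduled task after `t < |agenda|` answers is the typed task, untyped. [folklore] -/
theorem utask_eq {prev : List Bool} (ht : prev.length < (agenda (QOf T n)).length) :
    utask (POf T n) prev = ((agenda (QOf T n)).getD prev.length Task.close).toU := by
  rw [utask, show uagenda (POf T n) = (agenda (QOf T n)).map Task.toU from (map_toU_agenda _).symm,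
    getD_map_of_lt Task.toU _ _ Task.close ht]

/-- Membership in the verifier language (definitional). [folklore] -/
theorem mem_LverOf (z : List Bool) :
    z ∈ LverOf T ↔ ucheck (POf T (fstF (fstF z)).length) (2 ^ (T.eval (fstF (fstF z)).length + 1))
      (ustate (POf T (fstF (fstF z)).length) (sndF (fstF z))) (utask (POf T (fstF (fstF z)).length) (sndF (fstF z))) (sndF z) = true :=
  Iff.rfl

/-- Membership in the statement language (definitional). [folklore] -/
theorem mem_LnpOf (w : List Bool) : w ∈ LnpOf T qc ↔ ∃ y : List Bool, y.length ≤ qc.eval w.length ∧ boolPair w y ∈ LverOf T :=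
  Iff.rfl

/-- Membership in the verifier language, on a genuine input. [folklore] -/
theorem mem_LverOf_iff (prev y : List Bool) :
    boolPair (boolPair (unaryEncodeNat n) prev) y ∈ LverOf T ↔
      ucheck (POf T n) (2 ^ (T.eval n + 1)) (ustate (POf T n) prev) (utask (POf T n) prev) y = true := by
  rw [mem_LverOf, fstF_boolPair, fstF_boolPair, sndF_boolPair, sndF_boolPair, length_unaryEncodeNat']

/-- The check of a scheduled task, unclamped (its scale is within `amax`). [folklore] -/
theorem ucheck_toU {τ : Task (QOf T n).D} (hmem : τ ∈ agenda (QOf T n)) (d : UData) (y : List Bool) :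
    ucheck (POf T n) (QOf T n).B d τ.toU y = (match τ with
      | Task.ex sc _ => uExCheck (POf T n) (QOf T n).B d sc y
      | Task.pf sc _ _ => uPfCheck (POf T n) (QOf T n).B d sc y
      | Task.st sc => uStCheck (POf T n) (QOf T n).B d sc y
      | Task.ap _ => uApCheck (POf T n) (POf T n).amax d y
      | _ => false) := by
  have hargs : τ.toU.ArgsLe (POf T n).amax := argsLe_of_mem_uagenda _ (toU_mem_uagenda (QOf T n) hmem)
  cases τ with
  | ex sc m' =>
    have : min sc (POf T n).amax = sc := min_eq_left (hargs sc (by simp [Task.toU, UTask.args]))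
    simp only [Task.toU, ucheck, this]
  | pf sc m' w =>
    have : min sc (POf T n).amax = sc := min_eq_left (hargs sc (by simp [Task.toU, UTask.args]))
    simp only [Task.toU, ucheck, this]
  | st sc =>
    have : min sc (POf T n).amax = sc := min_eq_left (hargs sc (by simp [Task.toU, UTask.args]))
    simp only [Task.toU, ucheck, this]
  | ap w => simp only [Task.toU, ucheck]
  | bs i k => simp only [Task.toU, ucheck]
  | eqGe i => simp only [Task.toU, ucheck]
  | eqLe i => simp only [Task.toU, ucheck]
  | fa i => simp only [Task.toU, ucheck]
  | close => simp only [Task.toU, ucheck]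
  | fin => simp only [Task.toU, ucheck]

/-- **The `NP` question of a scheduled `NP` task is answered by its typed statement.** For a task `τ`
of the schedule at a typed state `dat` whose untyped image is the replayed state, the statement
"`⟨1ⁿ, prev⟩ ∈ Lnp`" holds iff `npTruth … dat τ`, provided the certificate budget covers `Wf + 2 Wa`.
[cite: FournierKoiran2000, §2.1 (the conditions are checked "with a boolean NP algorithm")] -/
theorem mem_LnpOf_iff {prev : List Bool} {dat : Data (QOf T n).D} (hdat : ustate (POf T n) prev = dat.toU)
    (ht : prev.length < (agenda (QOf T n)).length) {τ : Task (QOf T n).D}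
    (hτ : (agenda (QOf T n)).getD prev.length Task.close = τ) (hsign : τ.isSign = false)
    (hqc : (QOf T n).Wf + 2 * (QOf T n).Wa ≤ qc.eval (boolPair (unaryEncodeNat n) prev).length) :
    boolPair (unaryEncodeNat n) prev ∈ LnpOf T qc ↔ npTruth (finT T n) (certOf (QOf T n)) dat τ := by
  have hmem : τ ∈ agenda (QOf T n) := by rw [← hτ, List.getD_eq_getElem _ _ ht]; exact List.getElem_mem _
  have hB : (2 : ℕ) ^ (T.eval n + 1) = (QOf T n).B := rfl
  -- the stable scale of the typed state is within `amax` (size invariant of the replayed state)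
  obtain ⟨K, hK⟩ := usz_ustate (POf T n) prev
  rw [hdat] at hK
  have hU : (dat.cur.stable.getD (0, [])).1 ≤ (POf T n).amax := by
    have hst := hK.cur.stSc
    rcases hs : dat.cur.stable with _ | ⟨sc, ch⟩
    · simp
    · have hmemst : sc ∈ dat.toU.cur.stable.map Prod.fst := by
        show sc ∈ (dat.cur.stable.map fun p => (p.1, p.2.map List.ofFn)).map Prod.fst
        rw [hs]; simp
      simpa using hst sc hmemst
  simp only [mem_LnpOf, mem_LverOf_iff, utask_eq ht, hτ, hdat, hB, ucheck_toU hmem]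
  cases τ with
  | ex sc m' =>
    constructor
    · rintro ⟨y, -, hy⟩; exact npTruth_ex_sound dat sc m' _ _ y hy
    · intro h
      obtain ⟨cert, hlen, hcert⟩ := npTruth_ex_complete dat sc m' _ _ h
      exact ⟨cert, by rw [hlen]; exact hqc, hcert⟩
  | pf sc m' w =>
    constructor
    · rintro ⟨y, -, hy⟩; exact npTruth_pf_sound dat sc m' w _ _ y hy
    · intro h
      obtain ⟨cert, hlen, hcert⟩ := npTruth_pf_complete dat sc m' w _ _ h
      exact ⟨cert, by rw [hlen]; exact hqc, hcert⟩
  | st sc =>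
    constructor
    · rintro ⟨y, -, hy⟩; exact npTruth_st_sound dat sc _ _ y hy
    · intro h
      obtain ⟨cert, hlen, hcert⟩ := npTruth_st_complete dat sc _ _ h
      exact ⟨cert, by rw [hlen]; exact hqc, hcert⟩
  | ap w =>
    constructor
    · rintro ⟨y, -, hy⟩; exact npTruth_ap_sound dat w _ _ hU y hy
    · intro h
      obtain ⟨cert, hlen, hcert⟩ := npTruth_ap_complete dat w _ _ hU h
      exact ⟨cert, by rw [hlen]; omega, hcert⟩
  | bs i k => exact absurd hsign (by simp [Task.isSign])
  | eqGe i => exact absurd hsign (by simp [Task.isSign])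
  | eqLe i => exact absurd hsign (by simp [Task.isSign])
  | fa i => exact absurd hsign (by simp [Task.isSign])
  | close => exact absurd hsign (by simp [Task.isSign])
  | fin => simp [npTruth, finT]

/-- **The sign question of a scheduled sign task is answered by the sign of its form at `x̂`**, provided
the probe budget `m(n)` covers the code of the probed list. [cite: FournierKoiran2000, §2.1 Step k, §2.3] -/
theorem signEnv_qryOf {prev : List Bool} {dat : Data (QOf T n).D} (hdat : ustate (POf T n) prev = dat.toU)
    (ht : prev.length < (agenda (QOf T n)).length) {τ : Task (QOf T n).D}
    (hτ : (agenda (QOf T n)).getD prev.length Task.close = τ)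
    (hm : (listE smE (probeOf T n prev)).length ≤ m.eval n) :
    signEnv x (qryOf T m n prev) = decide (0 ≤ aff (queryForm dat τ) (hat x)) := by
  have hmem : τ ∈ agenda (QOf T n) := by rw [← hτ, List.getD_eq_getElem _ _ ht]; exact List.getElem_mem _
  have hk : τ.toU.KLe (QOf T n).L := kLe_of_mem_uagenda (POf T n) (toU_mem_uagenda (QOf T n) hmem)
  have hprobe : probeOf T n prev = squeryList n (affToU (queryForm dat τ)) := by
    rw [probeOf, utask_eq ht, hdat, hτ, toU_queryForm dat τ hk]
  have hcode : listE smE (squeryList n (affToU (queryForm dat τ))) =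
      (encodingIntBool.listBool).encode (squeryList n (affToU (queryForm dat τ))) := by
    rw [listE_eq]; rfl
  rw [qryOf, takeD_eq_append_of_le _ _ hm, hprobe, hcode]
  exact signEnv_squeryList x (queryForm dat τ) _

/-- The next answer after a genuine prefix is the typed truthful answer. [cite: FournierKoiran2000, §2.1] -/
theorem nextAns_eq {prev : List Bool} {dat : Data (QOf T n).D} (hdat : ustate (POf T n) prev = dat.toU)
    (ht : prev.length < (agenda (QOf T n)).length)
    (hm : (listE smE (probeOf T n prev)).length ≤ m.eval n)
    (hqc : (QOf T n).Wf + 2 * (QOf T n).Wa ≤ qc.eval (boolPair (unaryEncodeNat n) prev).length) :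
    nextAns (isNPOf T) (qryOf T m) (LnpOf T qc) (signEnv x) n prev =
      truth (finT T n) (certOf (QOf T n)) (hat x) dat ((agenda (QOf T n)).getD prev.length Task.close) := by
  rw [nextAns, isNPOf, utask_eq ht, Task.isSign_toU, truth]
  by_cases hs : ((agenda (QOf T n)).getD prev.length Task.close).isSign = true
  · rw [if_neg (by rw [hs]; decide), if_pos hs]
    exact signEnv_qryOf hdat ht rfl hm
  · have hs' : ((agenda (QOf T n)).getD prev.length Task.close).isSign = false := Bool.eq_false_iff.2 hs
    rw [if_pos (by rw [hs']; decide), if_neg hs]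
    exact decide_eq_decide.2 (mem_LnpOf_iff hdat ht rfl hs' hqc)

/-- **The simulation.** Against `signEnv x`, for `t ≤ |agenda|`, the answers of the one-bit protocol are
the typed truthful answers and the replayed state is the untyped image of the typed state — given the
probe budget on the genuine prefixes and the certificate budget.
[cite: FournierKoiran2000, Thm 2 (the location protocol), Thm 3 (p. 11: its simulation)] -/
theorem answers_eq_tans
    (hm : ∀ t < (agenda (QOf T n)).length, (listE smE (probeOf T n (tans T n x t))).length ≤ m.eval n)
    (hqc : ∀ k, n ≤ k → (QOf T n).Wf + 2 * (QOf T n).Wa ≤ qc.eval k) :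
    ∀ t, t ≤ (agenda (QOf T n)).length →
      answers (isNPOf T) (qryOf T m) (LnpOf T qc) (signEnv x) n t = tans T n x t ∧
        ustate (POf T n) (tans T n x t) = (tdat T n x t).toU
  | 0, _ => ⟨rfl, by
      rw [tans, tdat, List.take_zero, runFrom_nil, toU_init, ustate_eq_foldl_zip, List.zip_nil_right, List.foldl_nil]
      exact rfl⟩
  | t + 1, ht => by
    obtain ⟨ih1, ih2⟩ := answers_eq_tans hm hqc t (Nat.le_of_succ_le ht)
    have ht' : t < (agenda (QOf T n)).length := ht
    have hlen : (tans T n x t).length = t := length_tans t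
    have hlt : (tans T n x t).length < (agenda (QOf T n)).length := by rw [hlen]; exact ht'
    have hltu : (tans T n x t).length < (uagenda (POf T n)).length := by
      rw [← map_toU_agenda, List.length_map]; exact hlt
    -- the next answer is the truthful one
    have hnext := nextAns_eq (x := x) ih2 hlt (hm t ht') (hqc _ (by rw [length_boolPair, length_unaryEncodeNat']; omega))
    rw [hlen] at hnext
    refine ⟨by rw [answers_succ, ih1, hnext]; rfl, ?_⟩
    -- the replayed state advances by the typed step
    show ustate (POf T n) (tans T n x t ++ [truth (finT T n) (certOf (QOf T n)) (hat x) (tdat T n x t) ((agenda (QOf T n)).getD t Task.close)]) =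
      (tdat T n x (t + 1)).toU
    rw [tdat_succ ht', step, toU_upd, ← ih2, ustate_eq_foldl_zip, ustate_eq_foldl_zip, zip_append_singleton_of_lt _ _ _ hltu,
      List.foldl_append, List.foldl_cons, List.foldl_nil]
    congr 1
    rw [← List.getD_eq_getElem (uagenda (POf T n)) UTask.fin hltu, ← utask, utask_eq hlt, hlen]

/-- **After the schedule**: for `t ≥ |agenda|` the replayed state of the genuine answers is the untyped
image of `finalData`, whose certificate is valid. [cite: FournierKoiran2000, Thm 2] -/
theorem ustate_answers
    (hm : ∀ t < (agenda (QOf T n)).length, (listE smE (probeOf T n (tans T n x t))).length ≤ m.eval n)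
    (hqc : ∀ k, n ≤ k → (QOf T n).Wf + 2 * (QOf T n).Wa ≤ qc.eval k) {t : ℕ} (ht : (agenda (QOf T n)).length ≤ t) :
    ustate (POf T n) (answers (isNPOf T) (qryOf T m) (LnpOf T qc) (signEnv x) n t) =
      (finalData (QOf T n) (finT T n) (hat x)).toU := by
  obtain ⟨k, rfl⟩ := Nat.exists_eq_add_of_le ht
  obtain ⟨e, he⟩ := answers_add (isNP := isNPOf T) (qry := qryOf T m) (Lnp := LnpOf T qc) (signEnv x) n (agenda (QOf T n)).length k
  obtain ⟨h1, h2⟩ := answers_eq_tans hm hqc (agenda (QOf T n)).length le_rfl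
  rw [he, h1, ustate_eq_foldl_zip, zip_append_of_length_le _ _ _ (by rw [← map_toU_agenda, List.length_map, length_tans]),
    ← ustate_eq_foldl_zip, h2, tdat_length]

end Simulation

end FKPointLocation

end Literature.Computability.Complexity
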